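import Mathlib
import HarnessLib
import Summits.AtomisticToContinuum.FouriersLaw.Theses.JunctionLocality
import Summits.AtomisticToContinuum.FouriersLaw.Theorems.JunctionLocalitySuperadditiveResistanceStubPlainForwardField
import Summits.AtomisticToContinuum.FouriersLaw.Theorems.JunctionLocalityConductanceLowerBoundStubRowSum
import Summits.AtomisticToContinuum.FouriersLaw.Theorems.JunctionLocalityConductanceLowerBoundStubFisherSquare
import Summits.AtomisticToContinuum.FouriersLaw.Theorems.JunctionLocalityConductanceLowerBoundStubKuboLink
import Summits.AtomisticToContinuum.FouriersLaw.Theorems.JunctionLocalityConductanceLowerBoundStubFarMomentumPoincare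
import Summits.AtomisticToContinuum.FouriersLaw.Theorems.JunctionLocalityConductanceLowerBoundHelperCouplingTransfer
import Summits.AtomisticToContinuum.FouriersLaw.Theorems.JunctionLocalityConductanceLowerBoundFloorEquivalence
import Summits.AtomisticToContinuum.FouriersLaw.Theorems.ConductanceLowerBound.Negative.HarmonicCornerLowerBound
import Summits.AtomisticToContinuum.FouriersLaw.Theorems.ConductanceLowerBound.Negative.GammaZeroNonUniqueness
import Summits.AtomisticToContinuum.FouriersLaw.Theorems.ConductanceLowerBound.Negative.NotInsulatorReduction

/-!
# Line `far-contact-fisher-square` — skeleton v3 for the crux `JunctionLocality.ConductanceLowerBound`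
(crux item stmt-AtomisticToContinuum-11749, rank 4, the POSITIVITY half `liminf_N D_N > 0`; routes
`route-AtomisticToContinuum-JunctionLocality` (primary), `route-AtomisticToContinuum-StaticAbelianSqueeze`)

Lead `prover-line-stmt-AtomisticToContinuum-11749-1`, 2026-08-16 (v1 = planner
`planner-cruxplan-stmt-AtomisticToContinuum-11749-far-contact-fisher-s-0`; card `Cruxes/ConductanceLowerBound/Ideas/far-contact-fisher-square.md`,
line card `Lines/far-contact-fisher-square.md`; triage TRIAGE-r1-1 / TRIAGE-r1-2: pass, pass).

Crux (FIXED, concluded BY NAME below): along unique weak steady-state families of `pinnedChain ω₂ lam β γ` (all `> 0`), for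
every `T > 0` and response coefficients `D_N`: `∃ c > 0 ∃ N₁ ∀ N ≥ N₁, c ≤ D_N`.

## State of the line after wave 1 (v3): EVERYTHING BUT THE BET IS LANDED

With `g` the equilibrium forward field of the LEFT bath of the `L`-chain (classical `C² ∩ L²(μ_T)`, mean `0`,
`L_{T,T} g = −(p_0² − T)`; existence `stub_plainForwardField`, LANDED; `μ_T = gibbsMeasure L T`, independent of `γ`):
* F1 Kubo link `D_L/(L−1) = γ(1 − (γ/T²)⟨g, k_0⟩)` — `ForecastSensitivity.stub_kuboLink`, LANDED p95958 (this lead; via the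
  δ-uniform CEHR mixing theorem `pinnedChain_uniformMixing` + lead-0's `stub_kuboLink_of_uniformMixingAt`);
* F2 row sum `⟨g,k_0⟩ + ⟨g,k_{L−1}⟩ = T²/γ` — `stub_rowSum`, LANDED p87148;  F3 Fisher square `⟨g,k_{L−1}⟩ = 2γT E_L(g)`,
  `E_L(g) := ‖∂_{p_{L−1}} g‖²` — `stub_fisherSquare`, LANDED p89790;
* hence `D_L = (L−1)(2γ³/T) E_L(g)` and **`ConductanceLowerBound ↔ TransmissionGradientFloor`** (`∃ c ∃ L₁ ∀ L ≥ L₁ ∀ g`,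
  `c ≤ (L−1)E_L(g)`) — `response_eq_dirichlet`, `conductanceLowerBound_iff_floor`, LANDED p96126 (this lead): the crux IS an
  equilibrium Dirichlet floor; the Dirichlet-floor bet is exactly crux-strength;
* P far-momentum Gaussian Poincaré `V_L(f) ≤ (π²/4) T E_L(f)` (resampling form, any chain, any site) — `stub_farMomentumPoincare`,
  LANDED p97215 (wave-1 worker);
* CT coupling transfer `γ₂²E(γ₂) ≤ γ₁²E(γ₁)`, `γ₁⁴E(γ₁) ≤ γ₂⁴E(γ₂)` for `γ₁ ≤ γ₂` (left forward fields of the same chain at two bath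
  couplings) — `helper_couplingTransfer_farGradient`, LANDED p99760 (wave-1 worker): the Dirichlet floor at ONE coupling gives it
  at every coupling (`(L−1)E(γ) ≥ min((γ'/γ)²,(γ'/γ)⁴)·(L−1)E(γ')`), so the bet may be stated at `γ = 1`.

## Registered stub (v3: ONE — the bet, RESHAPED to the unit-coupling slice)

* `stub_farKickVarianceFloorUnitCoupling` (THE BET, `N`-uniform, XL): for all `ω₂, lam, β, T > 0` there are `c > 0`, `L₁` with
  `c ≤ (L−1)·V_L(g)` for every `L ≥ L₁` (`L ≥ 2`) and every left forward field `g` of `pinnedChain ω₂ lam β 1` — resampling the FAR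
  contact's momentum from its Maxwellian changes the hot contact's injection potential by an rms amount `≳ L^{-1/2}`.  v1/v2's
  `stub_farKickVarianceFloor` (all `γ`) is this statement with `γ` free; by CT the composition needs only `γ = 1` (the variance
  floor at `γ = 1` ⇒ Dirichlet floor at `γ = 1` (P) ⇒ Dirichlet floor at every `γ` (CT) ⇒ crux (F1–F3)), so the registered target is
  the formally WEAKER unit-coupling slice.  STRONGER than the crux's `γ = 1` slice by the Poincaré loss only.  Harmonic corner
  `lam = β = 0`: `V_L ≥ T·E_L = O(1)` (ballistic) — consistent (Disproof §2b / Negative/HarmonicCornerLowerBound); `γ = 0`: not in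
  range (Negative/GammaZeroNonUniqueness).  No landed Negative lemma instantiates against it (the three Negative modules are imported
  as the scratch check).
* `ConductanceLowerBound_of` — kernel-checked composition (no sorry outside the stub).
-/

noncomputable section

open MeasureTheory Filter Topology ProbabilityTheory
open scoped ContDiff NNReal
open Literature.MathematicalPhysics.KineticTheory.HeatConduction
open Summit.AtomisticToContinuum.FouriersLaw.Theorems.SuperadditiveResistance.DeviceLiouville
  (kin kin_eq_sq liouvilleOp bathOp generator_eq_liouvilleOp_add)
open Summit.AtomisticToContinuum.FouriersLaw.Theorems.SuperadditiveResistance.Kubo (memLp_partialP)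
open Summit.AtomisticToContinuum.FouriersLaw.Cruxes.SuperadditiveResistance.FloatingProbeBypassLaplacian
  (plainForwardFields stub_plainForwardField pinnedChain_memLp_two_snd_sq)
open Summit.AtomisticToContinuum.FouriersLaw.Cruxes.ConductanceLowerBound.ForecastSensitivity
  (stub_rowSum stub_fisherSquare stub_kuboLink response_eq_dirichlet conductanceLowerBound_of_floor
    helper_couplingTransfer_farGradient)

namespace Summit.AtomisticToContinuum.FouriersLaw.Cruxes.ConductanceLowerBound.FarContactFisherSquare

/-! ## §1 The registered stub (the bet) -/

/-- **THE BET — FAR-KICK VARIANCE FLOOR AT UNIT COUPLING (`N`-uniform, XL).**  For all `ω₂, lam, β > 0` and `T > 0` there are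
`c > 0` and `L₁` such that for every `L ≥ L₁` (and `L ≥ 2`) every classical mean-zero `C² ∩ L²(μ_T)` left forward field `g` of
the `L`-chain `pinnedChain ω₂ lam β 1` (bath coupling `γ = 1`) satisfies
`c ≤ (L−1) · ∫ dμ_T(x) ∫ d𝒩(0,T)(s) (g(x) − g(q, p[L−1 ↦ s]))²`:
resampling the FAR contact's momentum from its Maxwellian changes the hot contact's injection potential by an rms amount
`≳ L^{-1/2}` — the far contact matters at CLT scale (the conditional MEAN effect is the mean-field `O(L^{-1})`; the floor is carried
by the configuration-dependent part).  The unit-coupling slice suffices by the LANDED coupling transfer (`γ²E ↓`, `γ⁴E ↑`); it is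
STRONGER than the crux's slice by the Poincaré loss only (`stub_farMomentumPoincare`).  Normal conduction predicts `(L−1)·V_L → const`;
harmonic corner: `V_L ≥ T·E_L = O(1)` (ballistic, holds with room); disordered pinned harmonic chain: both sides `≍ e^{−L/ξ}` (the floor
must spend translation invariance + anharmonic mixing).  No `N`-uniform bound of this kind is in print (barrier
`FixedLengthNoConductivityControl`). -/
theorem stub_farKickVarianceFloorUnitCoupling :
    ∀ (ω₂ lam β T : ℝ), 0 < ω₂ → 0 < lam → 0 < β → 0 < T →
      ∃ c : ℝ, 0 < c ∧ ∃ L₁ : ℕ, ∀ (L : ℕ) (hL : 2 ≤ L), L₁ ≤ L → ∀ g : PhaseSpace L → ℝ, ContDiff ℝ 2 g →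
        MemLp g 2 ((pinnedChain ω₂ lam β 1).gibbsMeasure L T) →
        ∫ x, g x ∂((pinnedChain ω₂ lam β 1).gibbsMeasure L T) = 0 →
        (∀ x, (pinnedChain ω₂ lam β 1).generator L T T g x = -(kin L 0 x - T)) →
        c ≤ ((L : ℝ) - 1) *
          ∫ x, (∫ s, (g x - g (x.1, Function.update x.2 (⟨L - 1, by omega⟩ : Fin L) s)) ^ 2
              ∂(gaussianReal 0 T.toNNReal)) ∂((pinnedChain ω₂ lam β 1).gibbsMeasure L T) := by
  sorry

/-! ## §2 Tools (sorry-free) -/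

/-- A classical forward field of the left bath has finite Fisher information at both contacts: `∂_{p_b} g ∈ L²(μ_T)` for
`b ∈ {0, L−1}` (finite entropy production; the tree's `Kubo.memLp_partialP`). [folklore] -/
theorem memLp_partialP_forwardField {ω₂ lam β γ T : ℝ} (hω : 0 < ω₂) (hl : 0 < lam) (hβ : 0 < β) (hγ : 0 < γ)
    (hT : 0 < T) {L : ℕ} (hL : 2 ≤ L) {g : PhaseSpace L → ℝ} (hgC : ContDiff ℝ 2 g)
    (hgL2 : MemLp g 2 ((pinnedChain ω₂ lam β γ).gibbsMeasure L T))
    (hgeq : ∀ x, (pinnedChain ω₂ lam β γ).generator L T T g x = -(kin L 0 x - T))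
    (i : Fin L) (hi : i.val = 0 ∨ i.val = L - 1) :
    MemLp (fun x => partialP i g x) 2 ((pinnedChain ω₂ lam β γ).gibbsMeasure L T) := by
  have hL0 : 0 < L := by omega
  set P := pinnedChain ω₂ lam β γ with hP
  set μ := P.gibbsMeasure L T with hμ
  set B := OscillatorChain.bathWeight L with hB
  haveI : IsProbabilityMeasure μ := pinnedChain_isProbabilityMeasure_gibbsMeasure hω hl.le hβ.le γ L hT
  have hBnn : ∀ j, 0 ≤ B j := fun j => by
    simp only [hB, OscillatorChain.bathWeight]
    positivity
  have hBi : 0 < B i := by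
    rcases hi with h | h
    · simp only [hB, OscillatorChain.bathWeight, h, if_true]
      split_ifs <;> norm_num
    · simp only [hB, OscillatorChain.bathWeight, h, if_true]
      split_ifs <;> norm_num
  have hk0L2 : MemLp (fun x => kin L 0 x - T) 2 μ :=
    ((pinnedChain_memLp_two_snd_sq hω hl.le hβ.le γ L hT ⟨0, hL0⟩).sub (memLp_const T)).ae_eq
      (ae_of_all _ fun x => by simp [kin_eq_sq hL0])
  have hpg : ∀ x, 1 * liouvilleOp P L g x + γ * bathOp L B T g x = -(kin L 0 x - T) := fun x => by
    rw [one_mul, ← hgeq x, generator_eq_liouvilleOp_add]; rfl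
  exact memLp_partialP hω hl.le hβ.le γ L hT B hBnn 1 hγ hgC hgL2 hk0L2 hpg hBi

/-- Elementary: from `V ≤ K·T·E`, `c ≤ (L−1)·V`, `K, T > 0` conclude `c/(K T) ≤ (L−1)·E`. [folklore] -/
theorem floor_transfer {V E K T c l : ℝ} (hK : 0 < K) (hT : 0 < T) (hl : 0 ≤ l) (hP : V ≤ K * T * E)
    (hc : c ≤ l * V) : c / (K * T) ≤ l * E := by
  rw [div_le_iff₀ (mul_pos hK hT)]
  calc c ≤ l * V := hc
    _ ≤ l * (K * T * E) := mul_le_mul_of_nonneg_left hP hl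
    _ = l * E * (K * T) := by ring

/-- The Gibbs measure of the pinned chain does not depend on the bath coupling. [folklore] -/
theorem gibbsMeasure_coupling_indep (ω₂ lam β γ γ' : ℝ) (L : ℕ) (T : ℝ) :
    (pinnedChain ω₂ lam β γ).gibbsMeasure L T = (pinnedChain ω₂ lam β γ').gibbsMeasure L T := rfl

/-! ## §3 The unit-coupling variance floor gives the Dirichlet floor at every coupling -/

/-- **Variance floor at `γ = 1` ⇒ Dirichlet floor at `γ = 1`** (constant `4c/(π²T)`), by the landed far-momentum Poincaré. -/
theorem dirichletFloor_unitCoupling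
    {ω₂ lam β T : ℝ} (hω : 0 < ω₂) (hl : 0 < lam) (hβ : 0 < β) (hT : 0 < T) :
    ∃ c : ℝ, 0 < c ∧ ∃ L₁ : ℕ, ∀ (L : ℕ) (hL : 2 ≤ L), L₁ ≤ L → ∀ g : PhaseSpace L → ℝ, ContDiff ℝ 2 g →
      MemLp g 2 ((pinnedChain ω₂ lam β 1).gibbsMeasure L T) →
      ∫ x, g x ∂((pinnedChain ω₂ lam β 1).gibbsMeasure L T) = 0 →
      (∀ x, (pinnedChain ω₂ lam β 1).generator L T T g x = -(kin L 0 x - T)) →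
      c ≤ ((L : ℝ) - 1) *
        ∫ x, (partialP (⟨L - 1, by omega⟩ : Fin L) g x) ^ 2 ∂((pinnedChain ω₂ lam β 1).gibbsMeasure L T) := by
  obtain ⟨c, hc, L₁, hfloor⟩ := stub_farKickVarianceFloorUnitCoupling ω₂ lam β T hω hl hβ hT
  refine ⟨c / (Real.pi ^ 2 / 4 * T), by positivity, L₁, fun L hL hL1 g hgC hgL2 hg0 hgeq => ?_⟩
  have hiR : (⟨L - 1, by omega⟩ : Fin L).val = 0 ∨ (⟨L - 1, by omega⟩ : Fin L).val = L - 1 := Or.inr rfl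
  have haL2 := memLp_partialP_forwardField hω hl hβ one_pos hT hL hgC hgL2 hgeq ⟨L - 1, by omega⟩ hiR
  have hP := stub_farMomentumPoincare (pinnedChain ω₂ lam β 1) L T hT ⟨L - 1, by omega⟩ g
    (hgC.of_le (by norm_num)) hgL2 haL2
  have hfl := hfloor L hL hL1 g hgC hgL2 hg0 hgeq
  have hLnn : (0 : ℝ) ≤ (L : ℝ) - 1 := by
    have : (2 : ℝ) ≤ L := by exact_mod_cast hL
    linarith
  exact floor_transfer (by positivity) hT hLnn hP hfl

/-- **Dirichlet floor at `γ = 1` ⇒ Dirichlet floor at every `γ > 0`** (constant `c·min(γ⁻², γ⁻⁴)`-type: `c/γ²` for `γ ≥ 1`,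
`c·γ⁴`… precisely `c / max (γ ^ 2) (1 / γ ^ 4)`), by the landed coupling transfer applied to the pair of couplings `{1, γ}` and
the landed existence of a left forward field at coupling `1`. -/
theorem transmissionGradientFloor_of_unitCouplingVarianceFloor :
    ∀ (ω₂ lam β γ T : ℝ), 0 < ω₂ → 0 < lam → 0 < β → 0 < γ → 0 < T →
      ∃ c : ℝ, 0 < c ∧ ∃ L₁ : ℕ, ∀ (L : ℕ) (hL : 2 ≤ L), L₁ ≤ L → ∀ g : PhaseSpace L → ℝ, ContDiff ℝ 2 g →
        MemLp g 2 ((pinnedChain ω₂ lam β γ).gibbsMeasure L T) →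
        ∫ x, g x ∂((pinnedChain ω₂ lam β γ).gibbsMeasure L T) = 0 →
        (∀ x, (pinnedChain ω₂ lam β γ).generator L T T g x = -(kin L 0 x - T)) →
        c ≤ ((L : ℝ) - 1) *
          ∫ x, (partialP (⟨L - 1, by omega⟩ : Fin L) g x) ^ 2 ∂((pinnedChain ω₂ lam β γ).gibbsMeasure L T) := by
  intro ω₂ lam β γ T hω hl hβ hγ hT
  obtain ⟨c, hc, L₁, hfloor⟩ := dirichletFloor_unitCoupling hω hl hβ hT
  -- the transfer factor between couplings `1` and `γ`
  refine ⟨c * min (γ ^ 2) (1 / γ ^ 4), by positivity, L₁, fun L hL hL1 g hgC hgL2 hg0 hgeq => ?_⟩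
  -- a left forward field at unit coupling (landed existence)
  obtain ⟨g₁, hg₁C, hg₁L2, hg₁0, hg₁eq⟩ := stub_plainForwardField ω₂ lam β 1 T hω hl hβ one_pos hT L hL
  have hfl : c ≤ ((L : ℝ) - 1) *
      ∫ x, (partialP (⟨L - 1, by omega⟩ : Fin L) g₁ x) ^ 2 ∂((pinnedChain ω₂ lam β 1).gibbsMeasure L T) :=
    hfloor L hL hL1 g₁ hg₁C hg₁L2 hg₁0 hg₁eq
  set E₁ : ℝ := ∫ x, (partialP (⟨L - 1, by omega⟩ : Fin L) g₁ x) ^ 2 ∂((pinnedChain ω₂ lam β 1).gibbsMeasure L T)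
    with hE₁
  set E : ℝ := ∫ x, (partialP (⟨L - 1, by omega⟩ : Fin L) g x) ^ 2 ∂((pinnedChain ω₂ lam β γ).gibbsMeasure L T)
    with hE
  have hEnn : 0 ≤ E := integral_nonneg fun x => sq_nonneg _
  have hE₁nn : 0 ≤ E₁ := integral_nonneg fun x => sq_nonneg _
  have hLnn : (0 : ℝ) ≤ (L : ℝ) - 1 := by
    have : (2 : ℝ) ≤ L := by exact_mod_cast hL
    linarith
  have hmin0 : 0 < min (γ ^ 2) (1 / γ ^ 4) := by positivity
  -- `min(γ², γ⁻⁴)·E₁ ≤ E` from the coupling transfer in the two orderings of `{1, γ}`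
  have hkey : min (γ ^ 2) (1 / γ ^ 4) * E₁ ≤ E := by
    rcases le_total 1 γ with h1γ | hγ1
    · -- `1 ≤ γ`: `1⁴·E₁ ≤ γ⁴·E`
      obtain ⟨-, h2⟩ := helper_couplingTransfer_farGradient ω₂ lam β 1 γ T hω hl hβ one_pos h1γ hT L hL g₁ g
        hg₁C hg₁L2 hg₁0 hg₁eq hgC hgL2 hg0 hgeq
      have h2' : E₁ ≤ γ ^ 4 * E := by simpa [hE₁, hE] using h2
      have hγ4 : 0 < γ ^ 4 := by positivity
      calc min (γ ^ 2) (1 / γ ^ 4) * E₁ ≤ 1 / γ ^ 4 * E₁ := mul_le_mul_of_nonneg_right (min_le_right _ _) hE₁nn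
        _ ≤ 1 / γ ^ 4 * (γ ^ 4 * E) := mul_le_mul_of_nonneg_left h2' (by positivity)
        _ = E := by field_simp
    · -- `γ ≤ 1`: `1²·E₁ ≤ γ²·E`
      obtain ⟨h1, -⟩ := helper_couplingTransfer_farGradient ω₂ lam β γ 1 T hω hl hβ hγ hγ1 hT L hL g g₁
        hgC hgL2 hg0 hgeq hg₁C hg₁L2 hg₁0 hg₁eq
      have h1' : E₁ ≤ γ ^ 2 * E := by simpa [hE₁, hE] using h1
      calc min (γ ^ 2) (1 / γ ^ 4) * E₁ ≤ γ ^ 2 * E₁ := mul_le_mul_of_nonneg_right (min_le_left _ _) hE₁nn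
        _ ≤ γ ^ 2 * (γ ^ 2 * E) := mul_le_mul_of_nonneg_left h1' (by positivity)
        _ = γ ^ 4 * E := by ring
        _ ≤ 1 * E := by
            refine mul_le_mul_of_nonneg_right ?_ hEnn
            calc γ ^ 4 ≤ 1 ^ 4 := by gcongr
              _ = 1 := one_pow 4
        _ = E := one_mul E
  calc c * min (γ ^ 2) (1 / γ ^ 4) = min (γ ^ 2) (1 / γ ^ 4) * c := mul_comm _ _
    _ ≤ min (γ ^ 2) (1 / γ ^ 4) * (((L : ℝ) - 1) * E₁) := mul_le_mul_of_nonneg_left hfl hmin0.le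
    _ = ((L : ℝ) - 1) * (min (γ ^ 2) (1 / γ ^ 4) * E₁) := by ring
    _ ≤ ((L : ℝ) - 1) * E := mul_le_mul_of_nonneg_left hkey hLnn

/-! ## §3b Named forms and the diagnostic converse bridge (NOT registered stubs)

The gap between the variance floor and the Dirichlet floor is the Poincaré loss `k_eff(g) := T·E_L(g)/(V_L(g)/2) ∈ [1, ∞]` — the
effective Hermite degree of the dependence of `g` on the far momentum at fixed environment (`T·E_L = Σ_k k‖g_k‖²`,
`V_L/2 = Σ_{k≥1} ‖g_k‖²`).  Triage r1-1's live risk ("roughness of `p_{L−1} ↦ g` under bulk chaos") is `k_eff → ∞` with `L`; its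
negation in rigorous form is the reverse Poincaré inequality `BathBandLimit` (heuristic: the far momentum reaches the bulk only
through the boundary oscillator's path, into which it enters additively against that bath's own white noise at finite,
`L`-independent SNR, so the conditional expectation has geometrically decaying Hermite coefficients).  Under it the two floors are
equivalent. -/

/-- The Dirichlet floor (all couplings), verbatim the statement of `ForecastSensitivity.stub_transmissionGradientFloor`; by the landed
`conductanceLowerBound_iff_floor` it is EQUIVALENT to the crux. -/
def TransmissionGradientFloor : Prop :=
  ∀ (ω₂ lam β γ T : ℝ), 0 < ω₂ → 0 < lam → 0 < β → 0 < γ → 0 < T →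
    ∃ c : ℝ, 0 < c ∧ ∃ L₁ : ℕ, ∀ (L : ℕ) (hL : 2 ≤ L), L₁ ≤ L → ∀ g : PhaseSpace L → ℝ, ContDiff ℝ 2 g →
      MemLp g 2 ((pinnedChain ω₂ lam β γ).gibbsMeasure L T) →
      ∫ x, g x ∂((pinnedChain ω₂ lam β γ).gibbsMeasure L T) = 0 →
      (∀ x, (pinnedChain ω₂ lam β γ).generator L T T g x = -(kin L 0 x - T)) →
      c ≤ ((L : ℝ) - 1) *
        ∫ x, (partialP (⟨L - 1, by omega⟩ : Fin L) g x) ^ 2 ∂((pinnedChain ω₂ lam β γ).gibbsMeasure L T)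

/-- The variance floor at all couplings (v1/v2's registered bet `stub_farKickVarianceFloor`, kept as a named proposition). -/
def FarKickVarianceFloor : Prop :=
  ∀ (ω₂ lam β γ T : ℝ), 0 < ω₂ → 0 < lam → 0 < β → 0 < γ → 0 < T →
    ∃ c : ℝ, 0 < c ∧ ∃ L₁ : ℕ, ∀ (L : ℕ) (hL : 2 ≤ L), L₁ ≤ L → ∀ g : PhaseSpace L → ℝ, ContDiff ℝ 2 g →
      MemLp g 2 ((pinnedChain ω₂ lam β γ).gibbsMeasure L T) →
      ∫ x, g x ∂((pinnedChain ω₂ lam β γ).gibbsMeasure L T) = 0 →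
      (∀ x, (pinnedChain ω₂ lam β γ).generator L T T g x = -(kin L 0 x - T)) →
      c ≤ ((L : ℝ) - 1) *
        ∫ x, (∫ s, (g x - g (x.1, Function.update x.2 (⟨L - 1, by omega⟩ : Fin L) s)) ^ 2
            ∂(gaussianReal 0 T.toNNReal)) ∂((pinnedChain ω₂ lam β γ).gibbsMeasure L T)

/-- **BATH BAND-LIMIT** (diagnostic conjecture; a reverse Poincaré inequality in the far bath momentum for forward fields,
UNIFORM in `L`): `∃ K ∀ L ≥ 2 ∀` left forward fields `g`, `T·‖∂_{p_{L−1}} g‖² ≤ K·V_L(g)`.  `K = 1` at the harmonic corner. -/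
def BathBandLimit : Prop :=
  ∀ (ω₂ lam β γ T : ℝ), 0 < ω₂ → 0 < lam → 0 < β → 0 < γ → 0 < T →
    ∃ K : ℝ, ∀ (L : ℕ) (hL : 2 ≤ L) (g : PhaseSpace L → ℝ), ContDiff ℝ 2 g →
      MemLp g 2 ((pinnedChain ω₂ lam β γ).gibbsMeasure L T) →
      ∫ x, g x ∂((pinnedChain ω₂ lam β γ).gibbsMeasure L T) = 0 →
      (∀ x, (pinnedChain ω₂ lam β γ).generator L T T g x = -(kin L 0 x - T)) →
      T * ∫ x, (partialP (⟨L - 1, by omega⟩ : Fin L) g x) ^ 2 ∂((pinnedChain ω₂ lam β γ).gibbsMeasure L T) ≤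
        K * ∫ x, (∫ s, (g x - g (x.1, Function.update x.2 (⟨L - 1, by omega⟩ : Fin L) s)) ^ 2
            ∂(gaussianReal 0 T.toNNReal)) ∂((pinnedChain ω₂ lam β γ).gibbsMeasure L T)

/-- The Dirichlet floor follows from the registered unit-coupling variance floor (restating §3 against the named proposition). -/
theorem transmissionGradientFloor_holds : TransmissionGradientFloor :=
  transmissionGradientFloor_of_unitCouplingVarianceFloor

/-- The all-coupling variance floor trivially contains the registered unit-coupling slice's content: it implies the Dirichlet floor
too (P at every coupling; no transfer needed). -/
theorem transmissionGradientFloor_of_farKickVarianceFloor (hV : FarKickVarianceFloor) : TransmissionGradientFloor := by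
  intro ω₂ lam β γ T hω hl hβ hγ hT
  obtain ⟨c, hc, L₁, hfloor⟩ := hV ω₂ lam β γ T hω hl hβ hγ hT
  refine ⟨c / (Real.pi ^ 2 / 4 * T), by positivity, L₁, fun L hL hL1 g hgC hgL2 hg0 hgeq => ?_⟩
  have hiR : (⟨L - 1, by omega⟩ : Fin L).val = 0 ∨ (⟨L - 1, by omega⟩ : Fin L).val = L - 1 := Or.inr rfl
  have haL2 := memLp_partialP_forwardField hω hl hβ hγ hT hL hgC hgL2 hgeq ⟨L - 1, by omega⟩ hiR
  have hP := stub_farMomentumPoincare (pinnedChain ω₂ lam β γ) L T hT ⟨L - 1, by omega⟩ g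
    (hgC.of_le (by norm_num)) hgL2 haL2
  have hfl := hfloor L hL hL1 g hgC hgL2 hg0 hgeq
  have hLnn : (0 : ℝ) ≤ (L : ℝ) - 1 := by
    have : (2 : ℝ) ≤ L := by exact_mod_cast hL
    linarith
  exact floor_transfer (by positivity) hT hLnn hP hfl

/-- **Converse bridge.**  Under `BathBandLimit` the Dirichlet floor implies the variance floor (all couplings), so the two bets are
equivalent: `c·T/max(K,1) ≤ (L−1)·V_L(g)`.  (Sorry-free; pure bookkeeping.) -/
theorem farKickVarianceFloor_of_bathBandLimit (hB : BathBandLimit) (hF : TransmissionGradientFloor) :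
    FarKickVarianceFloor := by
  intro ω₂ lam β γ T hω hl hβ hγ hT
  obtain ⟨K, hK⟩ := hB ω₂ lam β γ T hω hl hβ hγ hT
  obtain ⟨c, hc, L₁, hfloor⟩ := hF ω₂ lam β γ T hω hl hβ hγ hT
  refine ⟨c * T / max K 1, by positivity, L₁, fun L hL hL1 g hgC hgL2 hg0 hgeq => ?_⟩
  have h1 := hK L hL g hgC hgL2 hg0 hgeq
  have h2 := hfloor L hL hL1 g hgC hgL2 hg0 hgeq
  set E : ℝ := ∫ x, (partialP (⟨L - 1, by omega⟩ : Fin L) g x) ^ 2 ∂((pinnedChain ω₂ lam β γ).gibbsMeasure L T) with hE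
  set V : ℝ := ∫ x, (∫ s, (g x - g (x.1, Function.update x.2 (⟨L - 1, by omega⟩ : Fin L) s)) ^ 2
      ∂(gaussianReal 0 T.toNNReal)) ∂((pinnedChain ω₂ lam β γ).gibbsMeasure L T) with hV
  have hVnn : 0 ≤ V := integral_nonneg fun x => integral_nonneg fun s => sq_nonneg _
  have hLnn : (0 : ℝ) ≤ (L : ℝ) - 1 := by
    have : (2 : ℝ) ≤ L := by exact_mod_cast hL
    linarith
  have hM : 0 < max K 1 := lt_of_lt_of_le one_pos (le_max_right K 1)
  have h3 : c * T ≤ ((L : ℝ) - 1) * (K * V) := by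
    calc c * T ≤ ((L : ℝ) - 1) * E * T := by nlinarith
      _ = ((L : ℝ) - 1) * (T * E) := by ring
      _ ≤ ((L : ℝ) - 1) * (K * V) := mul_le_mul_of_nonneg_left h1 hLnn
  have h4 : K * V ≤ max K 1 * V := mul_le_mul_of_nonneg_right (le_max_left K 1) hVnn
  rw [div_le_iff₀ hM]
  calc c * T ≤ ((L : ℝ) - 1) * (K * V) := h3
    _ ≤ ((L : ℝ) - 1) * (max K 1 * V) := mul_le_mul_of_nonneg_left h4 hLnn
    _ = ((L : ℝ) - 1) * V * max K 1 := by ring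

/-! ## §4 The composition (sorry-free outside the stub) -/

/-- **COMPOSITION (the registered stub + the landed trunk prove the crux BY NAME).**  Unit-coupling variance floor ⇒ Dirichlet
floor at `γ = 1` (far-momentum Poincaré, p97215) ⇒ Dirichlet floor at every `γ` (coupling transfer, p99760) ⇒
`ConductanceLowerBound` (`conductanceLowerBound_of_floor`, p96126: Kubo link p95958 ∘ row sum p87148 ∘ Fisher square p89790 give
`D_L = (L−1)(2γ³/T)E_L(g)` for the landed left forward field `g`). -/
theorem ConductanceLowerBound_of :
    Summit.AtomisticToContinuum.FouriersLaw.Theses.JunctionLocality.ConductanceLowerBound :=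
  conductanceLowerBound_of_floor transmissionGradientFloor_of_unitCouplingVarianceFloor

end Summit.AtomisticToContinuum.FouriersLaw.Cruxes.ConductanceLowerBound.FarContactFisherSquare

end
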